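import Literature.Probability.LatticeModels.RandomCurrentsMixingCore
import HarnessLib

/-!
# The split-event hypothesis of the mixing core from per-pair bounds (Aizenman–Duminil-Copin 2021, Lemma 6.7: `G(u)ᶜ ⊆ ⋃ᵢ G_iᶜ`)

Topic `Literature/Probability/LatticeModels`. Theorems only: no definition and **no named fact is introduced**
(D-0026).

The hypothesis `hG` of the tree's `Current.mixingCore` (`RandomCurrentsMixingCore`; Aizenman–Duminil-Copin
2021, arXiv:1912.07973, §6.2, **Lemma 6.7**: "`P^{xu,uy}[G(u₁,…,u_t)ᶜ] ≤ s(n/N)^ε`") concerns the eight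
switched currents at once. Since `G(u) = ⋂ᵢ G_i` and the four pairs `(n_i, n'_i)` are independent under
`P^{xu,uy}`, it follows from the four one-pair bounds `P[G_iᶜ] ≤ ε_i` by the union bound — the printed "`s·`"
in `s(n/N)^ε`. This file proves exactly that reduction, in un-normalised form:

* `Current.splitFailInd_le_sum` — `𝟙[G(u)ᶜ] ≤ ∑ᵢ 𝟙[G_iᶜ]`;
* `Current.tsum_octoWeightSw_mul_splitFailInd_le` — if for each pair `i`,
  `∑_p w_i(p) 𝟙[G_iᶜ(p)] ≤ ε_i ∑_p w_i(p)` (`w_i` the pair weight of the switched measure), then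
  `∑_ω W_sw(ω) 𝟙[G(u)ᶜ] ≤ (∑ᵢ ε_i) ∑_ω W_sw(ω)`.

The one-pair bounds are the business of `SplitEventFailure` (crossings of annuli) and of the lattice
estimates (chain rule for backbones, sourceless crossings, infrared bound).

## References

* M. Aizenman, H. Duminil-Copin, Ann. of Math. 194 (2021), arXiv:1912.07973, §6.2, Lemma 6.7 (p. 24–25)
  [AizenmanDuminilCopinAnnals2021].
-/

noncomputable section

open Finset Filter
open scoped symmDiff ENNReal

namespace Literature.Probability.LatticeModels

variable {V : Type*} [Fintype V] [DecidableEq V] {G : SimpleGraph V} [DecidableRel G.Adj]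

namespace Current

variable {K : G.edgeFinset → ℝ}

open Classical in
/-- **The union bound `𝟙[G(u)ᶜ] ≤ ∑ᵢ 𝟙[G_iᶜ]`** (`G(u) = ⋂ᵢ G_i`). [cite: AizenmanDuminilCopinAnnals2021, arXiv:1912.07973 §6.2, proof of Lemma 6.7 ("Let G_i be the event that the current 𝐤_i exists", p. 25)] -/
theorem splitFailInd_le_sum (Ein Eout : Finset G.edgeFinset) (u y : Fin 4 → V) (ω : OctoCfg G) :
    splitFailInd Ein Eout u y ω ≤
      ∑ i, (if SplitEvent Ein Eout (u i) (y i) ((ω i).1 + (ω i).2) then 0 else 1) := by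
  unfold splitFailInd
  split_ifs with h
  · exact zero_le
  · push Not at h
    obtain ⟨i, hi⟩ := h
    calc (1 : ℝ≥0∞) = (if SplitEvent Ein Eout (u i) (y i) ((ω i).1 + (ω i).2) then 0 else 1) := by rw [if_neg hi]
      _ ≤ ∑ j, (if SplitEvent Ein Eout (u j) (y j) ((ω j).1 + (ω j).2) then 0 else 1) :=
          Finset.single_le_sum (f := fun j => if SplitEvent Ein Eout (u j) (y j) ((ω j).1 + (ω j).2) then (0 : ℝ≥0∞) else 1)
            (fun _ _ => zero_le) (Finset.mem_univ i)

open Classical in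
/-- The mass of a product weight against the failure indicator of ONE coordinate factorises:
`∑_ω (∏ⱼ wⱼ(ω j)) 𝟙[G_iᶜ(ω i)] = (∑_p w_i(p)𝟙[G_iᶜ(p)]) · ∏_{j ≠ i} ∑_p wⱼ(p)`. [folklore] -/
theorem tsum_multiPairWeight_mul_failInd_eq (K : G.edgeFinset → ℝ) (A B : Fin 4 → Finset V)
    (Ein Eout : Finset G.edgeFinset) (u y : Fin 4 → V) (i : Fin 4) :
    ∑' ω : OctoCfg G, multiPairWeight K A B ω * (if SplitEvent Ein Eout (u i) (y i) ((ω i).1 + (ω i).2) then 0 else 1) =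
      ∏ j, ∑' p : Current G × Current G, epairWeight K (A j) (B j) p *
        (if j = i then (if SplitEvent Ein Eout (u i) (y i) (p.1 + p.2) then 0 else 1) else 1) := by
  have hpt : ∀ ω : OctoCfg G, multiPairWeight K A B ω * (if SplitEvent Ein Eout (u i) (y i) ((ω i).1 + (ω i).2) then 0 else 1) =
      ∏ j, epairWeight K (A j) (B j) (ω j) *
        (if j = i then (if SplitEvent Ein Eout (u i) (y i) ((ω j).1 + (ω j).2) then 0 else 1) else 1) := by
    intro ω
    unfold multiPairWeight
    rw [Finset.prod_mul_distrib]
    congr 1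
    rw [Finset.prod_ite_eq' Finset.univ i]
    simp
  simp_rw [hpt]
  rw [tsum_pi_fin_prod 4 (fun j p => epairWeight K (A j) (B j) p *
    (if j = i then (if SplitEvent Ein Eout (u i) (y i) (p.1 + p.2) then 0 else 1) else 1))]

open Classical in
/-- **Lemma 6.7 from its one-pair versions** (union bound over the four pairs of the switched measure): if for
every pair `i`, `∑_p w_i(p)𝟙[G_iᶜ(p)] ≤ ε_i ∑_p w_i(p)`, then `∑_ω W_sw(ω)𝟙[G(u)ᶜ(ω)] ≤ (∑ᵢ ε_i) ∑_ω W_sw(ω)` —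
the hypothesis `hG` of `Current.mixingCore` with `ε_G = ∑ᵢ ε_i` (printed: `s(n/N)^ε`).
[cite: AizenmanDuminilCopinAnnals2021, arXiv:1912.07973 §6.2, Lemma 6.7 (p. 24–25)] -/
theorem tsum_octoWeightSw_mul_splitFailInd_le (K : G.edgeFinset → ℝ) (Ein Eout : Finset G.edgeFinset)
    (w x₁ x₂ y₁ y₂ v₁ v₂ : V) (ε : Fin 4 → ℝ≥0∞)
    (h : ∀ i : Fin 4, ∑' p : Current G × Current G,
        epairWeight K ({octoX w x₁ x₂ i} ∆ {octoU w v₁ v₂ i}) ({octoU w v₁ v₂ i} ∆ {octoY w y₁ y₂ i}) p *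
          (if SplitEvent Ein Eout (octoU w v₁ v₂ i) (octoY w y₁ y₂ i) (p.1 + p.2) then 0 else 1) ≤
      ε i * ∑' p : Current G × Current G,
        epairWeight K ({octoX w x₁ x₂ i} ∆ {octoU w v₁ v₂ i}) ({octoU w v₁ v₂ i} ∆ {octoY w y₁ y₂ i}) p) :
    ∑' ω : OctoCfg G, octoWeightSw K w x₁ x₂ y₁ y₂ v₁ v₂ ω *
        splitFailInd Ein Eout (octoU w v₁ v₂) (octoY w y₁ y₂) ω ≤
      (∑ i, ε i) * ∑' ω : OctoCfg G, octoWeightSw K w x₁ x₂ y₁ y₂ v₁ v₂ ω := by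
  set A : Fin 4 → Finset V := fun i => {octoX w x₁ x₂ i} ∆ {octoU w v₁ v₂ i} with hA
  set B : Fin 4 → Finset V := fun i => {octoU w v₁ v₂ i} ∆ {octoY w y₁ y₂ i} with hB
  set U := octoU w v₁ v₂ with hU
  set Y := octoY w y₁ y₂ with hY
  have hW : ∀ ω : OctoCfg G, octoWeightSw K w x₁ x₂ y₁ y₂ v₁ v₂ ω = multiPairWeight K A B ω := fun ω => rfl
  -- the total mass as a product over the pairs
  have htot : ∑' ω : OctoCfg G, octoWeightSw K w x₁ x₂ y₁ y₂ v₁ v₂ ω =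
      ∏ j, ∑' p : Current G × Current G, epairWeight K (A j) (B j) p := by
    simp_rw [hW]
    unfold multiPairWeight
    exact tsum_pi_fin_prod 4 fun j p => epairWeight K (A j) (B j) p
  calc ∑' ω : OctoCfg G, octoWeightSw K w x₁ x₂ y₁ y₂ v₁ v₂ ω * splitFailInd Ein Eout U Y ω
      ≤ ∑' ω : OctoCfg G, octoWeightSw K w x₁ x₂ y₁ y₂ v₁ v₂ ω *
          ∑ i, (if SplitEvent Ein Eout (U i) (Y i) ((ω i).1 + (ω i).2) then 0 else 1) :=
        ENNReal.tsum_le_tsum fun ω => mul_le_mul' le_rfl (splitFailInd_le_sum Ein Eout U Y ω)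
    _ = ∑ i, ∑' ω : OctoCfg G, multiPairWeight K A B ω *
          (if SplitEvent Ein Eout (U i) (Y i) ((ω i).1 + (ω i).2) then 0 else 1) := by
        simp_rw [hW, Finset.mul_sum]
        exact Summable.tsum_finsetSum fun _ _ => ENNReal.summable
    _ = ∑ i, ∏ j, ∑' p : Current G × Current G, epairWeight K (A j) (B j) p *
          (if j = i then (if SplitEvent Ein Eout (U i) (Y i) (p.1 + p.2) then 0 else 1) else 1) :=
        Finset.sum_congr rfl fun i _ => tsum_multiPairWeight_mul_failInd_eq K A B Ein Eout U Y i
    _ ≤ ∑ i, ε i * ∏ j, ∑' p : Current G × Current G, epairWeight K (A j) (B j) p := by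
        refine Finset.sum_le_sum fun i _ => ?_
        -- isolate the factor `j = i`
        rw [← Finset.mul_prod_erase Finset.univ _ (Finset.mem_univ i), ← Finset.mul_prod_erase Finset.univ
          (fun j => ∑' p : Current G × Current G, epairWeight K (A j) (B j) p) (Finset.mem_univ i), ← mul_assoc]
        simp only [if_true]
        refine mul_le_mul' (h i) (le_of_eq (Finset.prod_congr rfl fun j hj => ?_))
        rw [Finset.mem_erase] at hj
        simp [hj.1]
    _ = (∑ i, ε i) * ∑' ω : OctoCfg G, octoWeightSw K w x₁ x₂ y₁ y₂ v₁ v₂ ω := by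
        rw [htot, Finset.sum_mul]

end Current

end Literature.Probability.LatticeModels
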